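import Summits.QuantumFields.BalabanUV.Beta.FP.PerfectBiStencilStep
import Summits.QuantumFields.BalabanUV.Beta.FP.PerfectTableFixedPointSym
import Summits.QuantumFields.BalabanUV.Beta.GAN24.ValueReadoutLipschitz

/-!
# `BalabanUV.Beta.FP.PerfectBiStencilFixedPoint` — road «FP» for binder row D1, row **N1-J∞-W PART 3(a)** (owner d1-p3 g13, journal STAMPS l.31813 (2)), FILE B of 2:
# THE S₂-SLOT LIMIT EQUATION — `S₂∞ = (cE₂·Lc^{2(d+1)}) • e4OfKW Lc G∞ S∞ M∞ W∞ + cB • vh₂S` — from the continuity of an2's resolvent-generic fourth value jet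
# `e4OfKW = mmRead Lc ∘ K3OfK` along rate families (§1) and FILE A's `j`-independent rescaled step (`PerfectBiStencilStep.unitS₂_T2RecOf_succ'`); the (0.4)
# literal's instance (§3) and the version over the END's own rows + table letters (§4, fed by leaf-06's companion `PerfectTableFixedPointSym`)

HONEST DEPENDENCY (page 1, mandatory): continuum YM on T⁴ ⇐ BetaPertH ∧ nine spine estimates (0/9 proved); BetaPertH ⇐ (D1) ∧ (D4) ∧ CAP+tail;
G-an2-4 gates asym, D1 and NE2/3/4.  HONEST FRAMING (cell contract, verbatim): «discharging `BetaPertH` makes Bałaban's UV stability UNCONDITIONAL —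
a real constructive-QFT result; it is NOT the continuum limit and NOT the Clay problem.»  ABSOLUTE RULE (cell charter, verbatim): «No internally-minted
statement may enter as a cited fact. Every hypothesis is either kernel-proved in this package or a verbatim quotation of a PUBLISHED theorem with page
reference. The manuscript(s) under audit are NOT citable for their own disputed steps — they are the thing under adjudication; programme-internal
(2001/route/tribunal) claims are never citable.»  THIS MODULE is [folklore] kernel bookkeeping (entrywise limits of absolutely convergent lattice sums; no `def`,
no `def … : Prop`, nothing cited, 0 sorry).  Every rate ∕ row below is a HYPOTHESIS SHAPE with free constants, asserted for no object of Bałaban's.  0∕4 row-D1 binders;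
discharges NO (CONV-C) row and NO table letter; NOT N2, NOT SDF, NOT D1, NOT BetaPertH, NOT continuum, NOT Clay.  «not in print; our bookkeeping».

WHY (owner d1-p3 g12∕g13, `JETS-JM-DESIGN.md` v2 §4 (d); `LEAVES-FP.md` l.549–550; STAMP l.31813 (2)).  The second-order fixed-point equation of the literal (leaf-02 g12
`PerfectTableFixedPoint.limTabOf_unitW_JsB12Sym0_eq`; leaf-06 g13 `PerfectTableFixedPointSym.…_of_rows`) reads `W∞ = W2SymOfK G∞ Lc S♭∞ M∞ S₂∞ M₂∞` with `S₂∞` a DISPLAYED slot;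
but `S₂` has its own recursion (an2's `RecursiveWSlot.T2RecOf_succ`), which in the adopted units is ONE `j`-free map (FILE A).  Passing `j → ∞` INSIDE that map needs the
continuity of `e4OfKW` in its four slots, whose Lipschitz form is ALREADY a tree theorem of the G-an2-4 swarm (gan24-leaf-08's
`GAN24/ValueReadoutLipschitz.locStencil₂_mmRead_K3OfK_sub` + `lK3_mul`, over leaf-03's `SecondOrderLipschitz` engine).  This file turns it into entrywise convergence along
rate families (asym1's `HessKerDressedLimit.tendsto_of_biLoc_rate`) and closes the (S₂) slot's «own recursion via `e4OfKW` not limit-typed» AS AN EQUATION; the (S₂) rows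
`{C₂ c₂ δ₂ θ₂}` themselves stay DISPLAYED (their own binder group, owner l.31813 (1)).

CONTENT.
* §1 **`locStencil₂_e4OfKW_sub_of_rows`** (the RATE ROW OF THE IMAGE): K∕S∕M rows (uniform, limit, geometric rate to named limits) at `(m, θ)`, W rows
  `VertexFamily₂ (W j) Lc Cw mW` ∕ `… Winf …` ∕ `VertexFamily₂ (W j − Winf) Lc (cW·θW^j) mW` at THEIR OWN `(mW, θW)` + swap symmetry ⟹
  `LocStencil₂ (e4OfKW Lc (K j) (S j) (M j) (W j) − e4OfKW Lc Kinf Sinf Minf Winf) (lK3 … (m₀∕4) · θ₀^j) (m₀∕128)`, `m₀ := min m mW`, `θ₀ := max θ θW` (currency merge, then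
  leaf-08's theorem BY NAME); **`tendsto_e4OfKW`**, **`limTabOf_e4OfKW_eq`**: `limTabOf (j ↦ e4OfKW Lc (K j) (S j) (M j) (W j)) = e4OfKW Lc Kinf Sinf Minf Winf`.
* §2 **`limit_eq_quartic_add_border`** — THE S₂ FIXED-POINT EQUATION for `T2RecOf d Lc G S M cE₂ cB T vh₂S mixFF` (generic `d`; (ShB₂) displayed; §1's rows on
  `G̃_j := unitK_j (G j)`, `S̃_j`, `M̃_j`, `W̃_j := unitW_j (WrecOf … j)` with named limits; ONE S₂ rate row `LocStencil₂ (unitS₂_j (T2RecOf … j) − S₂inf) (c₂·θ₂^j) δ₂`):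
  `S₂inf = fun κ u κ′ u′ ↦ (cE₂·Lc^{2(d+1)}) • e4OfKW Lc Ginf Sinf Minf Winf κ u κ′ u′ + cB • vh₂S κ u κ′ u′` (`tendsto_nhds_unique`: member `j+1` → `S₂inf` by the rate row, and,
  written through FILE A as `Φ_{S₂}` of the level-`j` data, → `Φ_{S₂}` of the limits by §1); `…_W2SymOfK` (`Winf := W2SymOfK Ginf Lc Sinf Minf S₂inf M₂inf`).
* §3 THE (0.4) LITERAL (`d + 1 = 4`, `Odd Lc`): **`limS₂_JsB12Sym_eq`** — under (ShB₂), the fifteen DISPLAYED slot rows of g12's `limTabOf_unitW_JsB12Sym0_eq` and the END's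
  W-rows `hW0 hWall0 hδW hθW0 hθW1` VERBATIM: `S₂inf = fun κ u κ′ u′ ↦ (Lc⁸·Lc^{2(3+1)}) • e4OfKW Lc Ginf S♭∞ M∞ (W2SymOfK Ginf Lc S♭∞ M∞ S₂inf M₂inf) κ u κ′ u′ + cB • tabs.vh₂S κ u κ′ u′`.
* §4 **`limS₂_JsB12Sym_eq_of_rows`** (`2 ≤ Lc`) — the same over leaf-06's inputs VERBATIM ((M-H)(ShH)(Shmix), the END's `hS0 hSall0 …`, the (S₂) rows `{C₂ c₂ δ₂ θ₂}`) +
  `hW0 hWall0 …` + (ShB₂), via `PerfectTableFixedPointSym.slotRows_holds` BY NAME.  AFTER THIS FILE the pair (W∞, S₂∞) of the literal solves the CLOSED system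
  `W∞ = W2SymOfK G∞ Lc S♭∞ M∞ S₂∞ M₂∞`, `S₂∞ = (cE₂·Lc⁸) • e4OfKW Lc G∞ S♭∞ M∞ W∞ + cB • vh₂S` modulo EXACTLY the END's displayed S∕W rows, (M-H)(ShH)(Shmix)(ShB₂) and the
  (S₂) rows.  PART 3(b) (the m ≥ 2 DEFINITION `Wt∞ m`, R-FP-41′ at the limit) is NOT here.
Provenance: D1 formalisation swarm LEAF PROVER 02, unit b2b-balaban-beta-d1-formalise-leaf-02 gen 13, 2026-08-21 (journal MINE «N1-J∞-W PART 3(a)», INTENT 1 l.31978).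
Over gan24-leaf-08's `ValueReadoutLipschitz`, asym1's `HessKerDressedLimit`, an2's `RecursiveWSlot` ∕ `SymmetrisedStepJets`, leaf-02 g12's `PerfectTableFixedPoint`, leaf-06 g13's
`PerfectTableFixedPointSym` BY NAME; no existing file touched.
-/

noncomputable section

namespace Summit.QuantumFields.BalabanUV.Beta.FP.PerfectBiStencilFixedPoint

open Filter Topology Literature.MathematicalPhysics.QuantumFieldTheory
open Literature.MathematicalPhysics.QuantumFieldTheory.Balaban1983to89
open Literature.MathematicalPhysics.QuantumFieldTheory.Balaban1983to89.Beta
open B12Sec2to5 (l1)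
open ExpKernelCalculus (MKer Decays BiLoc VertexFamily VertexFamily₂)
open OneStepResolventKernel (Fib LocStencil decays_mono)
open BalabanCompositeJets (LocStencil₂)
open BalabanStepJetsSucc (mmRead lamCoeffK)
open BalabanStepW2 (M2Of K3OfK)
open SecondOrderResponse (W2SymOfK W2SymOfK_swap LocStencilFM)
open InterLevelTransport (SLam)
open WilsonVertex2Sym (wsym22)
open AffineAveraging (toSite)  open AveragingContoursRooted (ctrOff)
open HessKerDressedLimit (limMKerOf limTabOf limStOf limTabOf_apply limMKerOf_eq_of_tendsto tendsto_of_biLoc_rate vertexFamily₂_limTabOf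
  vertexFamily₂_sub_limTabOf)
open Summit.QuantumFields.BalabanUV.Beta.HessKerDressedUnits (unitK unitS unitW counitK)
open Summit.QuantumFields.BalabanUV.Beta.SecondOrderUnits (unitM unitS₂ unitM₂)
open Summit.QuantumFields.BalabanUV.Beta.HessKerConvCKPlug (biLoc_mono' locStencil_mono' vertexFamily₂_mono')
open Summit.QuantumFields.BalabanUV.Beta.GAN24.CombesThomas (sfStep smStep)
open Summit.QuantumFields.BalabanUV.Beta.GAN24.WSlotCauchyOfShapes (mul_pow_le_mul_pow)
open Summit.QuantumFields.BalabanUV.Beta.GAN24.ValueReadoutLipschitz (lK3 locStencil₂_mmRead_K3OfK_sub lK3_mul)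
open Summit.QuantumFields.BalabanUV.Beta.SpineRooted (e4OfKW T2RecOf WrecOf WrecOf_swap M1Of)
open Summit.QuantumFields.BalabanUV.Beta.SymmetrisedDressingKernel (coDressKSymAt)
open Summit.QuantumFields.BalabanUV.Beta.SymmetrisedStepJets (SymTables Gsym SpureSymOf JsB12Sym0 JsB12Sym0_eq JsSym0Of_W)
open Summit.QuantumFields.BalabanUV.Beta.WardLocusStencils (ffK)
open Summit.QuantumFields.BalabanUV.Beta.FP.PerfectObjectsT (KPerf)
open Summit.QuantumFields.BalabanUV.Beta.FP.PerfectBiStencilStep (unitS₂_T2RecOf_succ')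
open Summit.QuantumFields.BalabanUV.Beta.FP.PerfectTableFixedPoint (limTabOf_unitW_JsB12Sym0_eq)
open Summit.QuantumFields.BalabanUV.Beta.FP.PerfectTableFixedPointSym (slotRows_holds limTabOf_unitW_JsB12Sym0_eq_of_rows)

variable {d : ℕ} {Lc : ℕ} [NeZero Lc]

/-! ## §1 The resolvent-generic fourth value jet is continuous along rate families -/

section Glue

variable {K : ℕ → MKer (d + 1) (Fib d)} {Kinf : MKer (d + 1) (Fib d)}
  {S : ℕ → Fin (d + 1) → (Fin (d + 1) → ℤ) → MKer (d + 1) (Fib d)} {Sinf : Fin (d + 1) → (Fin (d + 1) → ℤ) → MKer (d + 1) (Fib d)}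
  {M : ℕ → Fin (d + 1) → (Fin (d + 1) → ℤ) → MKer (d + 1) (Fib d)} {Minf : Fin (d + 1) → (Fin (d + 1) → ℤ) → MKer (d + 1) (Fib d)}
  {W : ℕ → Fin (d + 1) → (Fin (d + 1) → ℤ) → Fin (d + 1) → (Fin (d + 1) → ℤ) → MKer (d + 1) (Fib d)}
  {Winf : Fin (d + 1) → (Fin (d + 1) → ℤ) → Fin (d + 1) → (Fin (d + 1) → ℤ) → MKer (d + 1) (Fib d)}
  {C cK Cs cS CM cM Cw cW m θ mW θW : ℝ}

/-- [folklore] **THE RATE ROW OF THE IMAGE UNDER `e4OfKW`** (gan24-leaf-08's `locStencil₂_mmRead_K3OfK_sub` along a rate family, after a currency merge): with the K∕S∕M rows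
at `(m, θ)` (uniform, limit, geometric rate to the named limits) and the W rows at their own `(mW, θW)` plus the swap symmetry of every `W j` and of `Winf`,
`LocStencil₂ (e4OfKW Lc (K j) (S j) (M j) (W j) − e4OfKW Lc Kinf Sinf Minf Winf) (lK3 d C Cs CM Cw cK cS cM cW (m₀∕4) · θ₀^j) (m₀∕128)` for `m₀ := min m mW`, `θ₀ := max θ θW`. -/
theorem locStencil₂_e4OfKW_sub_of_rows
    (hK : ∀ j, Decays (K j) C m) (hKinf : Decays Kinf C m) (hKrate : ∀ j, Decays (K j - Kinf) (cK * θ ^ j) m)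
    (hS : ∀ j, LocStencil (S j) Cs m) (hSinf : LocStencil Sinf Cs m) (hSrate : ∀ j, LocStencil (S j - Sinf) (cS * θ ^ j) m)
    (hM : ∀ j, VertexFamily (M j) Lc CM m) (hMinf : VertexFamily Minf Lc CM m) (hMrate : ∀ j, VertexFamily (M j - Minf) Lc (cM * θ ^ j) m)
    (hm : 0 < m) (hθ0 : 0 ≤ θ)
    (hW : ∀ j, VertexFamily₂ (W j) Lc Cw mW) (hWinf : VertexFamily₂ Winf Lc Cw mW) (hWrate : ∀ j, VertexFamily₂ (W j - Winf) Lc (cW * θW ^ j) mW)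
    (hWs : ∀ j μ y ν y', W j ν y' μ y = W j μ y ν y') (hWinfs : ∀ μ y ν y', Winf ν y' μ y = Winf μ y ν y')
    (hmW : 0 < mW) (hθW0 : 0 ≤ θW) (j : ℕ) :
    LocStencil₂ (fun κ u κ' u' => e4OfKW Lc (K j) (S j) (M j) (W j) κ u κ' u' - e4OfKW Lc Kinf Sinf Minf Winf κ u κ' u')
      (lK3 d C Cs CM Cw cK cS cM cW (min m mW / 4) * (max θ θW) ^ j) (min m mW / 128) := by
  have hLc : 1 ≤ Lc := Nat.one_le_iff_ne_zero.mpr (NeZero.ne Lc)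
  have hC : 0 ≤ C := hKinf.nonneg (Sum.inl 0)
  have hcK : 0 ≤ cK := by simpa using (hKrate 0).nonneg (Sum.inl 0)
  have hCs : 0 ≤ Cs := (hSinf 0 0).nonneg (Sum.inl 0)
  have hcS : 0 ≤ cS := by simpa using ((hSrate 0) 0 0).nonneg (Sum.inl 0)
  have hCM : 0 ≤ CM := (hMinf 0 0).nonneg (Sum.inl 0)
  have hcM : 0 ≤ cM := by simpa using ((hMrate 0) 0 0).nonneg (Sum.inl 0)
  have hCw : 0 ≤ Cw := (hWinf 0 0 0 0).nonneg (Sum.inl 0)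
  have hcW : 0 ≤ cW := by simpa using ((hWrate 0) 0 0 0 0).nonneg (Sum.inl 0)
  have hm₀ : 0 < min m mW := lt_min hm hmW
  have hm₀m : min m mW ≤ m := min_le_left _ _
  have hm₀W : min m mW ≤ mW := min_le_right _ _
  have hθθ₀ : θ ≤ max θ θW := le_max_left _ _
  have hθWθ₀ : θW ≤ max θ θW := le_max_right _ _
  have hK' : Decays (K j) C (min m mW) := decays_mono (hK j) hC le_rfl hm₀m
  have hKinf' : Decays Kinf C (min m mW) := decays_mono hKinf hC le_rfl hm₀m
  have hKrate' : Decays (K j - Kinf) (cK * (max θ θW) ^ j) (min m mW) :=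
    decays_mono (hKrate j) (mul_nonneg hcK (pow_nonneg hθ0 j)) (mul_pow_le_mul_pow hcK hθ0 hθθ₀ j) hm₀m
  have hS' : LocStencil (S j) Cs (min m mW) := locStencil_mono' (hS j) hCs le_rfl hm₀m
  have hSinf' : LocStencil Sinf Cs (min m mW) := locStencil_mono' hSinf hCs le_rfl hm₀m
  have hSrate' : LocStencil (S j - Sinf) (cS * (max θ θW) ^ j) (min m mW) :=
    locStencil_mono' (hSrate j) (mul_nonneg hcS (pow_nonneg hθ0 j)) (mul_pow_le_mul_pow hcS hθ0 hθθ₀ j) hm₀m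
  have hM' : VertexFamily (M j) Lc CM (min m mW) := fun μ y => biLoc_mono' (hM j μ y) hCM le_rfl hm₀m
  have hMinf' : VertexFamily Minf Lc CM (min m mW) := fun μ y => biLoc_mono' (hMinf μ y) hCM le_rfl hm₀m
  have hMrate' : VertexFamily (M j - Minf) Lc (cM * (max θ θW) ^ j) (min m mW) := fun μ y =>
    biLoc_mono' (hMrate j μ y) (mul_nonneg hcM (pow_nonneg hθ0 j)) (mul_pow_le_mul_pow hcM hθ0 hθθ₀ j) hm₀m
  have hW' : VertexFamily₂ (W j) Lc Cw (min m mW) := vertexFamily₂_mono' (hW j) hCw le_rfl hm₀W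
  have hWinf' : VertexFamily₂ Winf Lc Cw (min m mW) := vertexFamily₂_mono' hWinf hCw le_rfl hm₀W
  have hWrate' : VertexFamily₂ (W j - Winf) Lc (cW * (max θ θW) ^ j) (min m mW) :=
    vertexFamily₂_mono' (hWrate j) (mul_nonneg hcW (pow_nonneg hθW0 j)) (mul_pow_le_mul_pow hcW hθW0 hθWθ₀ j) hm₀W
  have h := locStencil₂_mmRead_K3OfK_sub hLc hK' hKinf' hKrate' hm₀ hS' hSinf' hSrate' hM' hMinf' hMrate' hW' hWinf' hWrate' (hWs j) hWinfs
  rw [lK3_mul] at h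
  simpa only [e4OfKW] using h

/-- [folklore] **`e4OfKW` CONVERGES ENTRYWISE ALONG A RATE FAMILY** (`0 ≤ θ < 1`, `0 ≤ θW < 1`): every entry of `e4OfKW Lc (K j) (S j) (M j) (W j) κ u κ′ u′` tends to the
corresponding entry of `e4OfKW Lc Kinf Sinf Minf Winf κ u κ′ u′` (§1's rate row + asym1's `tendsto_of_biLoc_rate` at the ratio `max θ θW < 1`). -/
theorem tendsto_e4OfKW
    (hK : ∀ j, Decays (K j) C m) (hKinf : Decays Kinf C m) (hKrate : ∀ j, Decays (K j - Kinf) (cK * θ ^ j) m)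
    (hS : ∀ j, LocStencil (S j) Cs m) (hSinf : LocStencil Sinf Cs m) (hSrate : ∀ j, LocStencil (S j - Sinf) (cS * θ ^ j) m)
    (hM : ∀ j, VertexFamily (M j) Lc CM m) (hMinf : VertexFamily Minf Lc CM m) (hMrate : ∀ j, VertexFamily (M j - Minf) Lc (cM * θ ^ j) m)
    (hm : 0 < m) (hθ0 : 0 ≤ θ) (hθ1 : θ < 1)
    (hW : ∀ j, VertexFamily₂ (W j) Lc Cw mW) (hWinf : VertexFamily₂ Winf Lc Cw mW) (hWrate : ∀ j, VertexFamily₂ (W j - Winf) Lc (cW * θW ^ j) mW)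
    (hWs : ∀ j μ y ν y', W j ν y' μ y = W j μ y ν y') (hWinfs : ∀ μ y ν y', Winf ν y' μ y = Winf μ y ν y')
    (hmW : 0 < mW) (hθW0 : 0 ≤ θW) (hθW1 : θW < 1)
    (κ : Fin (d + 1)) (u : Fin (d + 1) → ℤ) (κ' : Fin (d + 1)) (u' : Fin (d + 1) → ℤ) (x z : Fin (d + 1) → ℤ) (a b : Fib d) :
    Tendsto (fun j => e4OfKW Lc (K j) (S j) (M j) (W j) κ u κ' u' x z a b) atTop (𝓝 (e4OfKW Lc Kinf Sinf Minf Winf κ u κ' u' x z a b)) := by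
  have hθ₀0 : 0 ≤ max θ θW := hθ0.trans (le_max_left _ _)
  have hθ₀1 : max θ θW < 1 := max_lt hθ1 hθW1
  have h : ∀ k, BiLoc (e4OfKW Lc (K k) (S k) (M k) (W k) κ u κ' u' - e4OfKW Lc Kinf Sinf Minf Winf κ u κ' u') u u
      ((lK3 d C Cs CM Cw cK cS cM cW (min m mW / 4) * Real.exp (-(min m mW / 128) * l1 (u' - u))) * (max θ θW) ^ k) (min m mW / 128) := fun k => by
    have h1 := locStencil₂_e4OfKW_sub_of_rows (Lc := Lc) hK hKinf hKrate hS hSinf hSrate hM hMinf hMrate hm hθ0 hW hWinf hWrate hWs hWinfs hmW hθW0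
      k κ u κ' u'
    simpa only [mul_right_comm] using h1
  exact tendsto_of_biLoc_rate (T := fun j => e4OfKW Lc (K j) (S j) (M j) (W j) κ u κ' u') h hθ₀0 hθ₀1 x z a b

/-- [folklore] **THE CONSTRUCTED LIMIT OF THE FOURTH VALUE JETS IS THE FOURTH VALUE JET OF THE LIMITS**:
`limTabOf (j ↦ e4OfKW Lc (K j) (S j) (M j) (W j)) = e4OfKW Lc Kinf Sinf Minf Winf` under the rows of `tendsto_e4OfKW`. -/
theorem limTabOf_e4OfKW_eq
    (hK : ∀ j, Decays (K j) C m) (hKinf : Decays Kinf C m) (hKrate : ∀ j, Decays (K j - Kinf) (cK * θ ^ j) m)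
    (hS : ∀ j, LocStencil (S j) Cs m) (hSinf : LocStencil Sinf Cs m) (hSrate : ∀ j, LocStencil (S j - Sinf) (cS * θ ^ j) m)
    (hM : ∀ j, VertexFamily (M j) Lc CM m) (hMinf : VertexFamily Minf Lc CM m) (hMrate : ∀ j, VertexFamily (M j - Minf) Lc (cM * θ ^ j) m)
    (hm : 0 < m) (hθ0 : 0 ≤ θ) (hθ1 : θ < 1)
    (hW : ∀ j, VertexFamily₂ (W j) Lc Cw mW) (hWinf : VertexFamily₂ Winf Lc Cw mW) (hWrate : ∀ j, VertexFamily₂ (W j - Winf) Lc (cW * θW ^ j) mW)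
    (hWs : ∀ j μ y ν y', W j ν y' μ y = W j μ y ν y') (hWinfs : ∀ μ y ν y', Winf ν y' μ y = Winf μ y ν y')
    (hmW : 0 < mW) (hθW0 : 0 ≤ θW) (hθW1 : θW < 1) :
    limTabOf (fun j => e4OfKW Lc (K j) (S j) (M j) (W j)) = e4OfKW Lc Kinf Sinf Minf Winf :=
  funext fun κ => funext fun u => funext fun κ' => funext fun u' => by
    rw [limTabOf_apply]
    exact limMKerOf_eq_of_tendsto fun x z a b =>
      tendsto_e4OfKW (Lc := Lc) hK hKinf hKrate hS hSinf hSrate hM hMinf hMrate hm hθ0 hθ1 hW hWinf hWrate hWs hWinfs hmW hθW0 hθW1 κ u κ' u' x z a b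

end Glue

/-! ## §2 The S₂ fixed-point equation of the slotted family `T2RecOf` -/

section Equation

variable (G : ℕ → MKer (d + 1) (Fib d)) (S M : ℕ → Fin (d + 1) → (Fin (d + 1) → ℤ) → MKer (d + 1) (Fib d)) (cE₂ cB : ℝ)
  (T : Fin 4 → Fin 4 → Fin 4 → Fin 4 → ℝ)
  (vh₂S mixFF : Fin (d + 1) → (Fin (d + 1) → ℤ) → Fin (d + 1) → (Fin (d + 1) → ℤ) → MKer (d + 1) (Fib d))
  {Ginf : MKer (d + 1) (Fib d)} {Sinf Minf : Fin (d + 1) → (Fin (d + 1) → ℤ) → MKer (d + 1) (Fib d)}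
  {Winf S₂inf M₂inf : Fin (d + 1) → (Fin (d + 1) → ℤ) → Fin (d + 1) → (Fin (d + 1) → ℤ) → MKer (d + 1) (Fib d)}
  {C cK Cs cS CM cM Cw cW c₂ m θ mW θW δ₂ θ₂ : ℝ}

omit [NeZero Lc] in
/-- [folklore] The unit-rescaled slotted W-tables are swap-symmetric (`WrecOf_swap`; `unitW` acts entrywise). -/
theorem unitW_WrecOf_swap (j : ℕ) (sf sm : ℝ) (μ : Fin (d + 1)) (y : Fin (d + 1) → ℤ) (ν : Fin (d + 1)) (y' : Fin (d + 1) → ℤ) :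
    unitW sf sm (WrecOf d Lc G S M cE₂ cB T vh₂S mixFF j) ν y' μ y = unitW sf sm (WrecOf d Lc G S M cE₂ cB T vh₂S mixFF j) μ y ν y' := by
  show counitK sf sm (WrecOf d Lc G S M cE₂ cB T vh₂S mixFF j ν y' μ y) = counitK sf sm (WrecOf d Lc G S M cE₂ cB T vh₂S mixFF j μ y ν y')
  rw [WrecOf_swap]

/-- [our object — bookkeeping] **THE S₂ FIXED-POINT EQUATION OF THE SLOTTED SECOND FIELD TABLES** (generic `d`).  HYPOTHESES, all DISPLAYED: (ShB₂) for `vh₂S`; the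
(CONV-C)-type rows of the unit-rescaled slots with NAMED limits — (G) `unitK_j (G j) → Ginf` (`Decays`), (S) `unitS_j (S j) → Sinf` (`LocStencil`), (M) `unitM_j (M j) → Minf`
(`VertexFamily _ Lc`) at `(m, θ)`; (W) `unitW_j (WrecOf … j) → Winf` (`VertexFamily₂ _ Lc`) at `(mW, θW)`, `Winf` swap-symmetric; ONE rate row
`LocStencil₂ (unitS₂_j (T2RecOf … j) − S₂inf) (c₂·θ₂^j) δ₂`.  CONCLUSION: `S₂inf = fun κ u κ′ u′ ↦ (cE₂·Lc^{2(d+1)}) • e4OfKW Lc Ginf Sinf Minf Winf κ u κ′ u′ + cB • vh₂S κ u κ′ u′`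
— member `j+1` tends to `S₂inf` (rate row) and, through `PerfectBiStencilStep.unitS₂_T2RecOf_succ'`, to the right-hand side (`tendsto_e4OfKW`); `tendsto_nhds_unique`. -/
theorem limit_eq_quartic_add_border
    (hBff : ∀ κ u κ' u' x y (α β : Fin (d + 1)), vh₂S κ u κ' u' x y (Sum.inl α) (Sum.inl β) = 0)
    (hBmm : ∀ κ u κ' u' x y (μ ν : Fin (d + 1)), vh₂S κ u κ' u' x y (Sum.inr μ) (Sum.inr ν) = 0)
    (hK : ∀ j, Decays (unitK (sfStep Lc j) (smStep d Lc j) (G j)) C m) (hKinf : Decays Ginf C m)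
    (hKrate : ∀ j, Decays (unitK (sfStep Lc j) (smStep d Lc j) (G j) - Ginf) (cK * θ ^ j) m)
    (hS : ∀ j, LocStencil (unitS (sfStep Lc j) (smStep d Lc j) (S j)) Cs m) (hSinf : LocStencil Sinf Cs m)
    (hSrate : ∀ j, LocStencil (unitS (sfStep Lc j) (smStep d Lc j) (S j) - Sinf) (cS * θ ^ j) m)
    (hM : ∀ j, VertexFamily (unitM (sfStep Lc j) (smStep d Lc j) (M j)) Lc CM m) (hMinf : VertexFamily Minf Lc CM m)
    (hMrate : ∀ j, VertexFamily (unitM (sfStep Lc j) (smStep d Lc j) (M j) - Minf) Lc (cM * θ ^ j) m)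
    (hm : 0 < m) (hθ0 : 0 ≤ θ) (hθ1 : θ < 1)
    (hW : ∀ j, VertexFamily₂ (unitW (sfStep Lc j) (smStep d Lc j) (WrecOf d Lc G S M cE₂ cB T vh₂S mixFF j)) Lc Cw mW)
    (hWinf : VertexFamily₂ Winf Lc Cw mW)
    (hWrate : ∀ j, VertexFamily₂ (unitW (sfStep Lc j) (smStep d Lc j) (WrecOf d Lc G S M cE₂ cB T vh₂S mixFF j) - Winf) Lc (cW * θW ^ j) mW)
    (hWinfs : ∀ μ y ν y', Winf ν y' μ y = Winf μ y ν y') (hmW : 0 < mW) (hθW0 : 0 ≤ θW) (hθW1 : θW < 1)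
    (hS₂rate : ∀ j, LocStencil₂ (unitS₂ (sfStep Lc j) (smStep d Lc j) (T2RecOf d Lc G S M cE₂ cB T vh₂S mixFF j) - S₂inf) (c₂ * θ₂ ^ j) δ₂)
    (hθ₂0 : 0 ≤ θ₂) (hθ₂1 : θ₂ < 1) :
    S₂inf = fun κ u κ' u' => (cE₂ * (Lc : ℝ) ^ (2 * (d + 1))) • e4OfKW Lc Ginf Sinf Minf Winf κ u κ' u' + cB • vh₂S κ u κ' u' := by
  have hWs : ∀ (j : ℕ) (μ : Fin (d + 1)) (y : Fin (d + 1) → ℤ) (ν : Fin (d + 1)) (y' : Fin (d + 1) → ℤ),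
      unitW (sfStep Lc j) (smStep d Lc j) (WrecOf d Lc G S M cE₂ cB T vh₂S mixFF j) ν y' μ y =
        unitW (sfStep Lc j) (smStep d Lc j) (WrecOf d Lc G S M cE₂ cB T vh₂S mixFF j) μ y ν y' :=
    fun j μ y ν y' => unitW_WrecOf_swap G S M cE₂ cB T vh₂S mixFF j _ _ μ y ν y'
  funext κ u κ' u' x z a b
  -- (1) the rate row: member `j+1` tends to `S₂inf`, entrywise
  have h1 : Tendsto (fun j => unitS₂ (sfStep Lc (j + 1)) (smStep d Lc (j + 1)) (T2RecOf d Lc G S M cE₂ cB T vh₂S mixFF (j + 1)) κ u κ' u' x z a b)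
      atTop (𝓝 (S₂inf κ u κ' u' x z a b)) := by
    have hr : ∀ k, BiLoc (unitS₂ (sfStep Lc k) (smStep d Lc k) (T2RecOf d Lc G S M cE₂ cB T vh₂S mixFF k) κ u κ' u' - S₂inf κ u κ' u') u u
        ((c₂ * Real.exp (-δ₂ * l1 (u' - u))) * θ₂ ^ k) δ₂ := fun k => by
      simpa only [Pi.sub_apply, mul_right_comm] using hS₂rate k κ u κ' u'
    exact (tendsto_of_biLoc_rate (T := fun k => unitS₂ (sfStep Lc k) (smStep d Lc k) (T2RecOf d Lc G S M cE₂ cB T vh₂S mixFF k) κ u κ' u')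
      hr hθ₂0 hθ₂1 x z a b).comp (tendsto_add_atTop_nat 1)
  -- (2) FILE A: member `j+1` is `Φ_{S₂}` of the level-`j` unit data, and `Φ_{S₂}` is continuous along the rows
  have h2 : Tendsto (fun j => unitS₂ (sfStep Lc (j + 1)) (smStep d Lc (j + 1)) (T2RecOf d Lc G S M cE₂ cB T vh₂S mixFF (j + 1)) κ u κ' u' x z a b)
      atTop (𝓝 ((cE₂ * (Lc : ℝ) ^ (2 * (d + 1))) * e4OfKW Lc Ginf Sinf Minf Winf κ u κ' u' x z a b + cB * vh₂S κ u κ' u' x z a b)) := by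
    have hlim := ((tendsto_e4OfKW (Lc := Lc) (K := fun j => unitK (sfStep Lc j) (smStep d Lc j) (G j))
      (S := fun j => unitS (sfStep Lc j) (smStep d Lc j) (S j)) (M := fun j => unitM (sfStep Lc j) (smStep d Lc j) (M j))
      (W := fun j => unitW (sfStep Lc j) (smStep d Lc j) (WrecOf d Lc G S M cE₂ cB T vh₂S mixFF j))
      hK hKinf hKrate hS hSinf hSrate hM hMinf hMrate hm hθ0 hθ1 hW hWinf hWrate hWs hWinfs hmW hθW0 hθW1 κ u κ' u' x z a b).const_mul
      (cE₂ * (Lc : ℝ) ^ (2 * (d + 1)))).add (tendsto_const_nhds (x := cB * vh₂S κ u κ' u' x z a b))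
    refine hlim.congr fun j => ?_
    rw [unitS₂_T2RecOf_succ' G S M cE₂ cB T vh₂S mixFF hBff hBmm j]
    simp only [Pi.add_apply, Pi.smul_apply, smul_eq_mul]
  have e := tendsto_nhds_unique h1 h2
  simp only [Pi.add_apply, Pi.smul_apply, smul_eq_mul]
  exact e

/-- [our object — bookkeeping] **… WITH THE W-LIMIT NAMED BY THE SECOND-ORDER FIXED-POINT EQUATION**: the same with `Winf := W2SymOfK Ginf Lc Sinf Minf S₂inf M₂inf` (its swap
symmetry is an1's `W2SymOfK_swap`) — then the pair `(W∞, S₂∞)` is displayed as a solution of the CLOSED system `W∞ = W2SymOfK G∞ Lc S∞ M∞ S₂∞ M₂∞`,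
`S₂∞ = (cE₂·Lc^{2(d+1)}) • e4OfKW Lc G∞ S∞ M∞ W∞ + cB • vh₂S`.  Discharges nothing. -/
theorem limit_eq_quartic_add_border_W2SymOfK
    (hBff : ∀ κ u κ' u' x y (α β : Fin (d + 1)), vh₂S κ u κ' u' x y (Sum.inl α) (Sum.inl β) = 0)
    (hBmm : ∀ κ u κ' u' x y (μ ν : Fin (d + 1)), vh₂S κ u κ' u' x y (Sum.inr μ) (Sum.inr ν) = 0)
    (hK : ∀ j, Decays (unitK (sfStep Lc j) (smStep d Lc j) (G j)) C m) (hKinf : Decays Ginf C m)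
    (hKrate : ∀ j, Decays (unitK (sfStep Lc j) (smStep d Lc j) (G j) - Ginf) (cK * θ ^ j) m)
    (hS : ∀ j, LocStencil (unitS (sfStep Lc j) (smStep d Lc j) (S j)) Cs m) (hSinf : LocStencil Sinf Cs m)
    (hSrate : ∀ j, LocStencil (unitS (sfStep Lc j) (smStep d Lc j) (S j) - Sinf) (cS * θ ^ j) m)
    (hM : ∀ j, VertexFamily (unitM (sfStep Lc j) (smStep d Lc j) (M j)) Lc CM m) (hMinf : VertexFamily Minf Lc CM m)
    (hMrate : ∀ j, VertexFamily (unitM (sfStep Lc j) (smStep d Lc j) (M j) - Minf) Lc (cM * θ ^ j) m)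
    (hm : 0 < m) (hθ0 : 0 ≤ θ) (hθ1 : θ < 1)
    (hW : ∀ j, VertexFamily₂ (unitW (sfStep Lc j) (smStep d Lc j) (WrecOf d Lc G S M cE₂ cB T vh₂S mixFF j)) Lc Cw mW)
    (hWinf : VertexFamily₂ (W2SymOfK Ginf Lc Sinf Minf S₂inf M₂inf) Lc Cw mW)
    (hWrate : ∀ j, VertexFamily₂ (unitW (sfStep Lc j) (smStep d Lc j) (WrecOf d Lc G S M cE₂ cB T vh₂S mixFF j) -
      W2SymOfK Ginf Lc Sinf Minf S₂inf M₂inf) Lc (cW * θW ^ j) mW)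
    (hmW : 0 < mW) (hθW0 : 0 ≤ θW) (hθW1 : θW < 1)
    (hS₂rate : ∀ j, LocStencil₂ (unitS₂ (sfStep Lc j) (smStep d Lc j) (T2RecOf d Lc G S M cE₂ cB T vh₂S mixFF j) - S₂inf) (c₂ * θ₂ ^ j) δ₂)
    (hθ₂0 : 0 ≤ θ₂) (hθ₂1 : θ₂ < 1) :
    S₂inf = fun κ u κ' u' =>
      (cE₂ * (Lc : ℝ) ^ (2 * (d + 1))) • e4OfKW Lc Ginf Sinf Minf (W2SymOfK Ginf Lc Sinf Minf S₂inf M₂inf) κ u κ' u' + cB • vh₂S κ u κ' u' :=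
  limit_eq_quartic_add_border G S M cE₂ cB T vh₂S mixFF hBff hBmm hK hKinf hKrate hS hSinf hSrate hM hMinf hMrate hm hθ0 hθ1 hW hWinf hWrate
    (fun μ y ν y' => W2SymOfK_swap _ _ _ _ _ _ μ y ν y') hmW hθW0 hθW1 hS₂rate hθ₂0 hθ₂1

end Equation

/-! ## §3 The (0.4) literal: the S₂ fixed-point equation under the displayed slot rows and the END's W-rows -/

section Literal

variable (hLc : Odd Lc) (N : ℕ) (tabs : SymTables 3 Lc) (cΛ cB : ℝ)
  {Ginf : MKer 4 (Fib 3)} {Sinf Minf : Fin 4 → (Fin 4 → ℤ) → MKer 4 (Fib 3)}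
  {S₂inf M₂inf : Fin 4 → (Fin 4 → ℤ) → Fin 4 → (Fin 4 → ℤ) → MKer 4 (Fib 3)} {C cK Cs cS CM cM C₂ c₂ CM₂ cM₂ m θ : ℝ}

/-- [folklore] The literal's second-order table at step `j` IS the slotted W-table over `(Gsym, SpureSymOf, tabs.M, tabs.vh₂S, tabs.mixFF)` at the pins
`(cE, cVH, cE₂, T) = (Lc⁴, −Lc⁸∕2, Lc⁸, (8N²)⁻¹•wsym22 N)` (`JsB12Sym0_eq`, `JsSym0Of_W`; `rfl`). -/
theorem JsB12Sym0_W_eq_WrecOf (j : ℕ) :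
    (JsB12Sym0 hLc N tabs cΛ cB j).W =
      WrecOf 3 Lc (Gsym Lc) (SpureSymOf tabs ((Lc : ℝ) ^ 4) (-((Lc : ℝ) ^ 8 / 2)) cΛ) tabs.M ((Lc : ℝ) ^ 8) cB ((8 * (N : ℝ) ^ 2)⁻¹ • wsym22 N)
        tabs.vh₂S tabs.mixFF j := by
  rw [JsB12Sym0_eq, JsSym0Of_W]
  rfl

/-- [our object — bookkeeping] **THE S₂ FIXED-POINT EQUATION AT THE (0.4) LITERAL** (`d + 1 = 4`, `Odd Lc`, free `N cΛ cB`).  HYPOTHESES = (ShB₂) for `tabs.vh₂S`; the END's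
W-rows `hW0 hWall0 hδW hθW0 hθW1` VERBATIM (`RoadLeftLiteralWard.d1Drift_JsB12Sym_of_sliceLedger_straight_wardTables`); the fifteen DISPLAYED slot rows of leaf-02 g12's
`PerfectTableFixedPoint.limTabOf_unitW_JsB12Sym0_eq`, one currency `(m, θ)`.  CONCLUSION:
`S₂inf = fun κ u κ′ u′ ↦ (Lc⁸·Lc^{2(3+1)}) • e4OfKW Lc Ginf S♭∞ M∞ (W2SymOfK Ginf Lc S♭∞ M∞ S₂inf M₂inf) κ u κ′ u′ + cB • tabs.vh₂S κ u κ′ u′` (the W-limit is g12's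
`W2SymOfK …`, its class and rate from the END's rows by asym1's `vertexFamily₂_limTabOf` ∕ `vertexFamily₂_sub_limTabOf`).  Discharges nothing. -/
theorem limS₂_JsB12Sym_eq
    (hBff : ∀ κ u κ' u' x y (α β : Fin 4), tabs.vh₂S κ u κ' u' x y (Sum.inl α) (Sum.inl β) = 0)
    (hBmm : ∀ κ u κ' u' x y (μ ν : Fin 4), tabs.vh₂S κ u κ' u' x y (Sum.inr μ) (Sum.inr ν) = 0)
    {Cw0 cW δW θW : ℝ}
    (hW0 : ∀ j, VertexFamily₂ (unitW (sfStep Lc j) (smStep 3 Lc j) (JsB12Sym0 hLc N tabs cΛ cB j).W) Lc Cw0 δW)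
    (hWall0 : ∀ k j, VertexFamily₂ (unitW (sfStep Lc (k + j)) (smStep 3 Lc (k + j)) (JsB12Sym0 hLc N tabs cΛ cB (k + j)).W -
      unitW (sfStep Lc k) (smStep 3 Lc k) (JsB12Sym0 hLc N tabs cΛ cB k).W) Lc (cW * θW ^ k) δW)
    (hδW : 0 < δW) (hθW0 : 0 ≤ θW) (hθW1 : θW < 1)
    (hK : ∀ j, Decays (unitK (sfStep Lc j) (smStep 3 Lc j) (Gsym (d := 3) Lc j)) C m) (hKinf : Decays Ginf C m)
    (hKrate : ∀ j, Decays (unitK (sfStep Lc j) (smStep 3 Lc j) (Gsym (d := 3) Lc j) - Ginf) (cK * θ ^ j) m)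
    (hS : ∀ j, LocStencil (unitS (sfStep Lc j) (smStep 3 Lc j) (SpureSymOf tabs ((Lc : ℝ) ^ 4) (-((Lc : ℝ) ^ 8 / 2)) cΛ j)) Cs m) (hSinf : LocStencil Sinf Cs m)
    (hSrate : ∀ j, LocStencil (unitS (sfStep Lc j) (smStep 3 Lc j) (SpureSymOf tabs ((Lc : ℝ) ^ 4) (-((Lc : ℝ) ^ 8 / 2)) cΛ j) - Sinf) (cS * θ ^ j) m)
    (hM : ∀ j, VertexFamily (unitM (sfStep Lc j) (smStep 3 Lc j) (tabs.M j)) Lc CM m) (hMinf : VertexFamily Minf Lc CM m)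
    (hMrate : ∀ j, VertexFamily (unitM (sfStep Lc j) (smStep 3 Lc j) (tabs.M j) - Minf) Lc (cM * θ ^ j) m)
    (hS₂ : ∀ j, LocStencil₂ (unitS₂ (sfStep Lc j) (smStep 3 Lc j) (T2RecOf 3 Lc (Gsym Lc) (SpureSymOf tabs ((Lc : ℝ) ^ 4) (-((Lc : ℝ) ^ 8 / 2)) cΛ) tabs.M
      ((Lc : ℝ) ^ 8) cB ((8 * (N : ℝ) ^ 2)⁻¹ • wsym22 N) tabs.vh₂S tabs.mixFF j)) C₂ m) (hS₂inf : LocStencil₂ S₂inf C₂ m)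
    (hS₂rate : ∀ j, LocStencil₂ (unitS₂ (sfStep Lc j) (smStep 3 Lc j) (T2RecOf 3 Lc (Gsym Lc) (SpureSymOf tabs ((Lc : ℝ) ^ 4) (-((Lc : ℝ) ^ 8 / 2)) cΛ) tabs.M
      ((Lc : ℝ) ^ 8) cB ((8 * (N : ℝ) ^ 2)⁻¹ • wsym22 N) tabs.vh₂S tabs.mixFF j) - S₂inf) (c₂ * θ ^ j) m)
    (hM₂ : ∀ j, LocStencilFM Lc (unitM₂ (sfStep Lc j) (smStep 3 Lc j) (M2Of 3 Lc tabs.mixFF j)) CM₂ m) (hM₂inf : LocStencilFM Lc M₂inf CM₂ m)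
    (hM₂rate : ∀ j, LocStencilFM Lc (unitM₂ (sfStep Lc j) (smStep 3 Lc j) (M2Of 3 Lc tabs.mixFF j) - M₂inf) (cM₂ * θ ^ j) m)
    (hm : 0 < m) (hθ0 : 0 ≤ θ) (hθ1 : θ < 1) :
    S₂inf = fun κ u κ' u' =>
      ((Lc : ℝ) ^ 8 * (Lc : ℝ) ^ (2 * (3 + 1))) • e4OfKW Lc Ginf Sinf Minf (W2SymOfK Ginf Lc Sinf Minf S₂inf M₂inf) κ u κ' u' + cB • tabs.vh₂S κ u κ' u' := by
  have eW : ∀ j, unitW (sfStep Lc j) (smStep 3 Lc j) (JsB12Sym0 hLc N tabs cΛ cB j).W = unitW (sfStep Lc j) (smStep 3 Lc j)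
      (WrecOf 3 Lc (Gsym Lc) (SpureSymOf tabs ((Lc : ℝ) ^ 4) (-((Lc : ℝ) ^ 8 / 2)) cΛ) tabs.M ((Lc : ℝ) ^ 8) cB ((8 * (N : ℝ) ^ 2)⁻¹ • wsym22 N)
        tabs.vh₂S tabs.mixFF j) := fun j => by rw [JsB12Sym0_W_eq_WrecOf]
  have hlim := limTabOf_unitW_JsB12Sym0_eq hLc N tabs cΛ cB hK hKinf hKrate hS hSinf hSrate hM hMinf hMrate hS₂ hS₂inf hS₂rate hM₂ hM₂inf hM₂rate hm hθ0 hθ1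
  have hWinf : VertexFamily₂ (W2SymOfK Ginf Lc Sinf Minf S₂inf M₂inf) Lc Cw0 δW := by
    rw [← hlim]
    exact vertexFamily₂_limTabOf (W := fun j => unitW (sfStep Lc j) (smStep 3 Lc j) (JsB12Sym0 hLc N tabs cΛ cB j).W) hW0 hWall0 hθW1
  have hWrate : ∀ j, VertexFamily₂ (unitW (sfStep Lc j) (smStep 3 Lc j)
      (WrecOf 3 Lc (Gsym Lc) (SpureSymOf tabs ((Lc : ℝ) ^ 4) (-((Lc : ℝ) ^ 8 / 2)) cΛ) tabs.M ((Lc : ℝ) ^ 8) cB ((8 * (N : ℝ) ^ 2)⁻¹ • wsym22 N)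
        tabs.vh₂S tabs.mixFF j) - W2SymOfK Ginf Lc Sinf Minf S₂inf M₂inf) Lc (cW * θW ^ j) δW := fun j => by
    rw [← eW j, ← hlim]
    exact vertexFamily₂_sub_limTabOf (W := fun j => unitW (sfStep Lc j) (smStep 3 Lc j) (JsB12Sym0 hLc N tabs cΛ cB j).W) hWall0 hθW1 j
  have hW : ∀ j, VertexFamily₂ (unitW (sfStep Lc j) (smStep 3 Lc j)
      (WrecOf 3 Lc (Gsym Lc) (SpureSymOf tabs ((Lc : ℝ) ^ 4) (-((Lc : ℝ) ^ 8 / 2)) cΛ) tabs.M ((Lc : ℝ) ^ 8) cB ((8 * (N : ℝ) ^ 2)⁻¹ • wsym22 N)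
        tabs.vh₂S tabs.mixFF j)) Lc Cw0 δW := fun j => by rw [← eW j]; exact hW0 j
  exact limit_eq_quartic_add_border_W2SymOfK (Gsym Lc) (SpureSymOf tabs ((Lc : ℝ) ^ 4) (-((Lc : ℝ) ^ 8 / 2)) cΛ) tabs.M ((Lc : ℝ) ^ 8) cB
    ((8 * (N : ℝ) ^ 2)⁻¹ • wsym22 N) tabs.vh₂S tabs.mixFF hBff hBmm hK hKinf hKrate hS hSinf hSrate hM hMinf hMrate hm hθ0 hθ1 hW hWinf hWrate hδW hθW0 hθW1
    hS₂rate hθ0 hθ1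

end Literal

/-! ## §4 The same over the END's own rows and the table letters (leaf-06's companion), `2 ≤ Lc` -/

section OfRows

variable (hOdd : Odd Lc) (N : ℕ) (tabs : SymTables 3 Lc) (cΛ cB : ℝ)

/-- [our object — bookkeeping] **THE S₂ FIXED-POINT EQUATION AT THE (0.4) LITERAL — (G) DISCHARGED, (S♭) REDUCED TO THE END's S-ROWS, (M)(M₂) AT THEIR OWN VALUES**
(`d + 1 = 4`, `2 ≤ Lc`, `Odd Lc`).  HYPOTHESES = leaf-06 g13's inputs VERBATIM (`PerfectTableFixedPointSym.limTabOf_unitW_JsB12Sym0_eq_of_rows`: (M-H) `hM1`, (ShH) `hHff`, (Shmix)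
`hmixff`, the END's `hS0 hSall0 hδS hθS0 hθS1`, the (S₂) rows `{C₂ c₂ δ₂ θ₂}`) + the END's `hW0 hWall0 hδW hθW0 hθW1` + (ShB₂).  With `K₁ := KPerf Lc (sfStep Lc) (smStep 3 Lc) 1`,
`G∞ := coDressKSymAt ρ_c Lc K₁`, `S♭∞ := limStOf (j ↦ unitS_j (JsB12Sym0 … j).S) − (cΛ·Lc^{2(3+1)}) • S^Λ[lamCoeffK K₁ (mmRead Lc K₁) Lc] tabs.H`, `M∞ := cΛ • tabs.H`,
`W∞ := W2SymOfK G∞ Lc S♭∞ M∞ S₂inf tabs.mixFF`: `S₂inf = fun κ u κ′ u′ ↦ (Lc⁸·Lc^{2(3+1)}) • e4OfKW Lc G∞ S♭∞ M∞ W∞ κ u κ′ u′ + cB • tabs.vh₂S κ u κ′ u′` — the pair `(W∞, S₂∞)`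
solves the CLOSED second-order system modulo EXACTLY the END's displayed S∕W rows, (M-H)(ShH)(Shmix)(ShB₂) and the (S₂) rows.  Discharges nothing. -/
theorem limS₂_JsB12Sym_eq_of_rows (hLc : 2 ≤ Lc)
    (hBff : ∀ κ u κ' u' x y (α β : Fin 4), tabs.vh₂S κ u κ' u' x y (Sum.inl α) (Sum.inl β) = 0)
    (hBmm : ∀ κ u κ' u' x y (μ ν : Fin 4), tabs.vh₂S κ u κ' u' x y (Sum.inr μ) (Sum.inr ν) = 0)
    {Cw0 cW δW θW : ℝ}
    (hW0 : ∀ j, VertexFamily₂ (unitW (sfStep Lc j) (smStep 3 Lc j) (JsB12Sym0 hOdd N tabs cΛ cB j).W) Lc Cw0 δW)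
    (hWall0 : ∀ k j, VertexFamily₂ (unitW (sfStep Lc (k + j)) (smStep 3 Lc (k + j)) (JsB12Sym0 hOdd N tabs cΛ cB (k + j)).W -
      unitW (sfStep Lc k) (smStep 3 Lc k) (JsB12Sym0 hOdd N tabs cΛ cB k).W) Lc (cW * θW ^ k) δW)
    (hδW : 0 < δW) (hθW0 : 0 ≤ θW) (hθW1 : θW < 1)
    (hM1 : ∀ (j : ℕ) (ρ : Fin 4) (w : Fin 4 → ℤ), tabs.M j ρ w = M1Of 3 Lc tabs.H cΛ j ρ w)
    (hHff : ∀ μ w, ffK (tabs.H μ w) = tabs.H μ w) (hmixff : ∀ κ u ρ w, ffK (tabs.mixFF κ u ρ w) = tabs.mixFF κ u ρ w)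
    {Cs0 cS δS θS : ℝ}
    (hS0 : ∀ j, LocStencil (unitS (sfStep Lc j) (smStep 3 Lc j) (JsB12Sym0 hOdd N tabs cΛ cB j).S) Cs0 δS)
    (hSall0 : ∀ k j, LocStencil (unitS (sfStep Lc (k + j)) (smStep 3 Lc (k + j)) (JsB12Sym0 hOdd N tabs cΛ cB (k + j)).S -
      unitS (sfStep Lc k) (smStep 3 Lc k) (JsB12Sym0 hOdd N tabs cΛ cB k).S) (cS * θS ^ k) δS)
    (hδS : 0 < δS) (hθS0 : 0 ≤ θS) (hθS1 : θS < 1)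
    {S₂inf : Fin 4 → (Fin 4 → ℤ) → Fin 4 → (Fin 4 → ℤ) → MKer 4 (Fib 3)} {C₂ c₂ δ₂ θ₂ : ℝ}
    (hS₂ : ∀ j, LocStencil₂ (unitS₂ (sfStep Lc j) (smStep 3 Lc j) (T2RecOf 3 Lc (Gsym Lc) (SpureSymOf tabs ((Lc : ℝ) ^ 4) (-((Lc : ℝ) ^ 8 / 2)) cΛ) tabs.M
      ((Lc : ℝ) ^ 8) cB ((8 * (N : ℝ) ^ 2)⁻¹ • wsym22 N) tabs.vh₂S tabs.mixFF j)) C₂ δ₂) (hS₂inf : LocStencil₂ S₂inf C₂ δ₂)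
    (hS₂rate : ∀ j, LocStencil₂ (unitS₂ (sfStep Lc j) (smStep 3 Lc j) (T2RecOf 3 Lc (Gsym Lc) (SpureSymOf tabs ((Lc : ℝ) ^ 4) (-((Lc : ℝ) ^ 8 / 2)) cΛ) tabs.M
      ((Lc : ℝ) ^ 8) cB ((8 * (N : ℝ) ^ 2)⁻¹ • wsym22 N) tabs.vh₂S tabs.mixFF j) - S₂inf) (c₂ * θ₂ ^ j) δ₂)
    (hδ₂ : 0 < δ₂) (hθ₂0 : 0 ≤ θ₂) (hθ₂1 : θ₂ < 1) :
    S₂inf = fun κ u κ' u' =>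
      ((Lc : ℝ) ^ 8 * (Lc : ℝ) ^ (2 * (3 + 1))) •
          e4OfKW Lc (coDressKSymAt (toSite (ctrOff (3 + 1) Lc)) Lc (KPerf (d := 3) Lc (sfStep Lc) (smStep 3 Lc) 1))
            (limStOf (fun j => unitS (sfStep Lc j) (smStep 3 Lc j) (JsB12Sym0 hOdd N tabs cΛ cB j).S) -
              fun κ u => (cΛ * (Lc : ℝ) ^ (2 * (3 + 1))) •
                SLam Lc (lamCoeffK (KPerf (d := 3) Lc (sfStep Lc) (smStep 3 Lc) 1) (mmRead Lc (KPerf (d := 3) Lc (sfStep Lc) (smStep 3 Lc) 1)) Lc) tabs.H κ u)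
            (fun μ w => cΛ • tabs.H μ w)
            (W2SymOfK (coDressKSymAt (toSite (ctrOff (3 + 1) Lc)) Lc (KPerf (d := 3) Lc (sfStep Lc) (smStep 3 Lc) 1)) Lc
              (limStOf (fun j => unitS (sfStep Lc j) (smStep 3 Lc j) (JsB12Sym0 hOdd N tabs cΛ cB j).S) -
                fun κ u => (cΛ * (Lc : ℝ) ^ (2 * (3 + 1))) •
                  SLam Lc (lamCoeffK (KPerf (d := 3) Lc (sfStep Lc) (smStep 3 Lc) 1) (mmRead Lc (KPerf (d := 3) Lc (sfStep Lc) (smStep 3 Lc) 1)) Lc) tabs.H κ u)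
              (fun μ w => cΛ • tabs.H μ w) S₂inf tabs.mixFF) κ u κ' u' +
        cB • tabs.vh₂S κ u κ' u' := by
  obtain ⟨C, cK, Cs, cS', CM, CM₂, C₂', c₂', m, θ, hm, hθ0, hθ1, hG, hGinf, hGrate, hSu, hSi, hSr, hM, hMinf, hMrate, hT, hTinf, hTrate,
    hX, hXinf, hXrate⟩ :=
    slotRows_holds hOdd N tabs cΛ cB hLc hM1 hHff hmixff hS0 hSall0 hδS hθS0 hθS1 hS₂ hS₂inf hS₂rate hδ₂ hθ₂0 hθ₂1
  exact limS₂_JsB12Sym_eq hOdd N tabs cΛ cB hBff hBmm hW0 hWall0 hδW hθW0 hθW1 hG hGinf hGrate hSu hSi hSr hM hMinf hMrate hT hTinf hTrate hX hXinf hXrate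
    hm hθ0 hθ1

end OfRows

end Summit.QuantumFields.BalabanUV.Beta.FP.PerfectBiStencilFixedPoint

end
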